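import Mathlib
import HarnessLib
import Summits.NavierStokesRegularity.NavierStokesRegularity.Theorems.TaylorModelRungThreeSoundnessVectorHigh

/-!
# Line `taylor-model` on crux K1b-DR (`ExactWindowRungThree.DerivativeEnclosureCertificateR`,
# stmt-NavierStokesRegularity-23954) — VECTOR STEP LEMMA, part 6: the DIFFERENCE block system (first differences
# of the flow WITHOUT derivatives — Lohner transport / (F3)(F5)-type clauses)

For two trajectories `ψ` (from `x₀`) and `ψ'` (from `x₀ + d₀`) the pair `(ψ, δ := ψ' − ψ)` solves the autonomous
BILINEAR block system `(y,d) ↦ (Q(y,y'), Q(y,d') + Q(d,y') + Q(d,d'))` on `ι ⊕ ι`, whose jets are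
`(T x k, T (x+d) k − T x k)` — so parts 1, 2 and 5 apply verbatim and give, with NO differentiability of the flow:
existence + confinement of the DIFFERENCE in a (small) box `[loD,hiD]` under a rough-enclosure test (first-order
or high-order), and the componentwise Lagrange remainder of the difference against the exact jet differences,
with a remainder constant `J c ≥ |T (y+d) (p+1) c − T y (p+1) c|` over the boxes (which scales with the size of `d`).

* `exists_diffJets` — the difference block field and jets, packaged (field equation, `T₃ z 0 = z`, recursion);
* `exists_pairDiff_sol_mem_Icc_of_roughEnclosure` / `…_of_highOrderEnclosure` — the two tests for `(ψ, ψ' − ψ)`;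
* `abs_diff_sub_taylor_le` (+ box form) — `|(ψ' s − ψ s) c − Σ_{k≤p} (T (ψ' 0) k − T (ψ 0) k) c s^k| ≤ J s^(p+1)`;
* `flowSel_diff_of_roughEnclosure` — `Fin n` / `flowSel` corollary (both selectors solve on `[0,h]`, the difference
  is confined to `[loD,hiD]` and obeys the difference remainder).

MODEL-lattice bookkeeping only (rung TL-M3 of the NS ladder: one finite-dimensional model ODE); nothing
here is a statement about the Navier–Stokes equations.
-/

noncomputable section

-- the sub-problem namespace repeats the summit name by design (D-0017)
set_option linter.dupNamespace false

namespace Summit.NavierStokesRegularity.NavierStokesRegularity.Theorems.TaylorModelVector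

open scoped BigOperators Topology
open Set Filter

section General

variable {ι : Type*} [Fintype ι] [DecidableEq ι]
  (Q : (ι → ℝ) →ₗ[ℝ] (ι → ℝ) →ₗ[ℝ] ι → ℝ) {T : (ι → ℝ) → ℕ → ι → ℝ}

omit [Fintype ι] [DecidableEq ι] in
/-- `Q (a+d) (a'+d') − Q a a' = Q a d' + Q d a' + Q d d'`. [folklore] -/
theorem quad_diff_expand (a d a' d' : ι → ℝ) :
    Q (a + d) (a' + d') - Q a a' = Q a d' + Q d a' + Q d d' := by
  rw [map_add Q, LinearMap.add_apply, map_add (Q a), map_add (Q d)]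
  abel

omit [Fintype ι] [DecidableEq ι] in
/-- **The difference block system with its jets**, packaged: the bilinear field
`(y,d),(y',d') ↦ (Q(y,y'), Q(y,d') + Q(d,y') + Q(d,d'))` on `ι ⊕ ι → ℝ` and the jets `(T x k, T (x+d) k − T x k)`
satisfy the Cauchy-product recursion. [folklore] -/
theorem exists_diffJets (hT0 : ∀ x, T x 0 = x)
    (hTs : ∀ x (k : ℕ) c, ((k : ℝ) + 1) * T x (k + 1) c =
      ∑ i ∈ Finset.range (k + 1), Q (T x i) (T x (k - i)) c) :
    ∃ (Q₃ : (ι ⊕ ι → ℝ) →ₗ[ℝ] (ι ⊕ ι → ℝ) →ₗ[ℝ] (ι ⊕ ι → ℝ)) (T₃ : (ι ⊕ ι → ℝ) → ℕ → ι ⊕ ι → ℝ),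
      (∀ z z' : ι ⊕ ι → ℝ, Q₃ z z' = Sum.elim (Q (z ∘ Sum.inl) (z' ∘ Sum.inl))
        (Q (z ∘ Sum.inl) (z' ∘ Sum.inr) + Q (z ∘ Sum.inr) (z' ∘ Sum.inl) + Q (z ∘ Sum.inr) (z' ∘ Sum.inr))) ∧
      (∀ z k, T₃ z k = Sum.elim (T (z ∘ Sum.inl) k) (T (z ∘ Sum.inl + z ∘ Sum.inr) k - T (z ∘ Sum.inl) k)) ∧
      (∀ z, T₃ z 0 = z) ∧
      (∀ z (k : ℕ) c₃, ((k : ℝ) + 1) * T₃ z (k + 1) c₃ =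
        ∑ i ∈ Finset.range (k + 1), Q₃ (T₃ z i) (T₃ z (k - i)) c₃) := by
  have hQ₃ : ∃ Q₃ : (ι ⊕ ι → ℝ) →ₗ[ℝ] (ι ⊕ ι → ℝ) →ₗ[ℝ] (ι ⊕ ι → ℝ), ∀ z z' : ι ⊕ ι → ℝ,
      Q₃ z z' = Sum.elim (Q (z ∘ Sum.inl) (z' ∘ Sum.inl))
        (Q (z ∘ Sum.inl) (z' ∘ Sum.inr) + Q (z ∘ Sum.inr) (z' ∘ Sum.inl) + Q (z ∘ Sum.inr) (z' ∘ Sum.inr)) := by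
    refine ⟨LinearMap.mk₂ ℝ (fun z z' : ι ⊕ ι → ℝ => Sum.elim (Q (z ∘ Sum.inl) (z' ∘ Sum.inl))
        (Q (z ∘ Sum.inl) (z' ∘ Sum.inr) + Q (z ∘ Sum.inr) (z' ∘ Sum.inl) + Q (z ∘ Sum.inr) (z' ∘ Sum.inr)))
        ?_ ?_ ?_ ?_, fun z z' => rfl⟩
    · intro z₁ z₂ z'
      have e1 : (z₁ + z₂) ∘ Sum.inl = z₁ ∘ Sum.inl + z₂ ∘ Sum.inl := rfl
      have e2 : (z₁ + z₂) ∘ Sum.inr = z₁ ∘ Sum.inr + z₂ ∘ Sum.inr := rfl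
      funext c
      rcases c with c | c
      · simp only [e1, Sum.elim_inl, Pi.add_apply, map_add, LinearMap.add_apply]
      · simp only [e1, e2, Sum.elim_inr, Pi.add_apply, map_add, LinearMap.add_apply]
        ring
    · intro r z z'
      have e1 : (r • z) ∘ Sum.inl = r • (z ∘ Sum.inl) := rfl
      have e2 : (r • z) ∘ Sum.inr = r • (z ∘ Sum.inr) := rfl
      funext c
      rcases c with c | c
      · simp only [e1, Sum.elim_inl, Pi.smul_apply, map_smul, LinearMap.smul_apply]
      · simp only [e1, e2, Sum.elim_inr, Pi.smul_apply, Pi.add_apply, map_smul, LinearMap.smul_apply,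
          smul_eq_mul]
        ring
    · intro z z₁ z₂
      have e1 : (z₁ + z₂) ∘ Sum.inl = z₁ ∘ Sum.inl + z₂ ∘ Sum.inl := rfl
      have e2 : (z₁ + z₂) ∘ Sum.inr = z₁ ∘ Sum.inr + z₂ ∘ Sum.inr := rfl
      funext c
      rcases c with c | c
      · simp only [e1, Sum.elim_inl, Pi.add_apply, map_add]
      · simp only [e1, e2, Sum.elim_inr, Pi.add_apply, map_add]
        ring
    · intro r z z'
      have e1 : (r • z') ∘ Sum.inl = r • (z' ∘ Sum.inl) := rfl
      have e2 : (r • z') ∘ Sum.inr = r • (z' ∘ Sum.inr) := rfl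
      funext c
      rcases c with c | c
      · simp only [e1, Sum.elim_inl, Pi.smul_apply, map_smul]
      · simp only [e1, e2, Sum.elim_inr, Pi.smul_apply, Pi.add_apply, map_smul, smul_eq_mul]
        ring
  obtain ⟨Q₃, hQ₃⟩ := hQ₃
  obtain ⟨T₃, hT₃⟩ : ∃ T₃ : (ι ⊕ ι → ℝ) → ℕ → ι ⊕ ι → ℝ,
      T₃ = fun z k => Sum.elim (T (z ∘ Sum.inl) k) (T (z ∘ Sum.inl + z ∘ Sum.inr) k - T (z ∘ Sum.inl) k) :=
    ⟨_, rfl⟩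
  refine ⟨Q₃, T₃, hQ₃, fun z k => by rw [hT₃], fun z => ?_, fun z k c₃ => ?_⟩
  · simp only [hT₃, hT0, add_sub_cancel_left, Sum.elim_comp_inl_inr]
  · simp only [hT₃, hQ₃, Sum.elim_comp_inl, Sum.elim_comp_inr]
    rcases c₃ with c | c
    · simp only [Sum.elim_inl]
      exact hTs _ k c
    · simp only [Sum.elim_inr, Pi.sub_apply]
      rw [mul_sub, hTs, hTs, ← Finset.sum_sub_distrib]
      refine Finset.sum_congr rfl fun i _ => ?_
      have e := quad_diff_expand Q (T (z ∘ Sum.inl) i) (T (z ∘ Sum.inl + z ∘ Sum.inr) i - T (z ∘ Sum.inl) i)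
        (T (z ∘ Sum.inl) (k - i)) (T (z ∘ Sum.inl + z ∘ Sum.inr) (k - i) - T (z ∘ Sum.inl) (k - i))
      rw [add_sub_cancel, add_sub_cancel] at e
      rw [← Pi.sub_apply, e]

/-- **Rough-enclosure test for (trajectory, DIFFERENCE)**: if `x₀ ∈ [lo,hi]`, `d₀ ∈ [loD,hiD]`,
`x₀ + u • Q y y ∈ [lo,hi]` and `d₀ + u • (Q y d + Q d y + Q d d) ∈ [loD,hiD]` for `y ∈ [lo,hi]`, `d ∈ [loD,hiD]`,
`u ∈ [0,h]`, then the solutions `ψ` from `x₀` and `ψ'` from `x₀ + d₀` exist on `[0,h]`, `ψ` stays in `[lo,hi]` and the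
DIFFERENCE `ψ' − ψ` stays in `[loD,hiD]`. [folklore] -/
theorem exists_pairDiff_sol_mem_Icc_of_roughEnclosure (hT0 : ∀ x, T x 0 = x)
    (hTs : ∀ x (k : ℕ) c, ((k : ℝ) + 1) * T x (k + 1) c =
      ∑ i ∈ Finset.range (k + 1), Q (T x i) (T x (k - i)) c)
    {lo hi x₀ loD hiD d₀ : ι → ℝ} {h : ℝ}
    (hx₀ : x₀ ∈ Icc lo hi) (hd₀ : d₀ ∈ Icc loD hiD) (hh : 0 ≤ h)
    (henc : ∀ y ∈ Icc lo hi, ∀ u ∈ Icc (0:ℝ) h, x₀ + u • Q y y ∈ Icc lo hi)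
    (hencD : ∀ y ∈ Icc lo hi, ∀ d ∈ Icc loD hiD, ∀ u ∈ Icc (0:ℝ) h,
      d₀ + u • (Q y d + Q d y + Q d d) ∈ Icc loD hiD) :
    ∃ ψ ψ' : ℝ → ι → ℝ, ψ 0 = x₀ ∧ ψ' 0 = x₀ + d₀ ∧
      (∀ s ∈ Icc 0 h, HasDerivWithinAt ψ (Q (ψ s) (ψ s)) (Icc 0 h) s) ∧
      (∀ s ∈ Icc 0 h, HasDerivWithinAt ψ' (Q (ψ' s) (ψ' s)) (Icc 0 h) s) ∧
      (∀ s ∈ Icc 0 h, ψ s ∈ Icc lo hi) ∧ (∀ s ∈ Icc 0 h, ψ' s - ψ s ∈ Icc loD hiD) := by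
  obtain ⟨Q₃, T₃, hQ₃, -, -, -⟩ := exists_diffJets Q hT0 hTs
  have hx₃ : Sum.elim x₀ d₀ ∈ Icc (Sum.elim lo loD) (Sum.elim hi hiD) := by
    refine ⟨?_, ?_⟩ <;> rintro (c | c)
    exacts [hx₀.1 c, hd₀.1 c, hx₀.2 c, hd₀.2 c]
  have henc₃ : ∀ y₃ ∈ Icc (Sum.elim lo loD) (Sum.elim hi hiD), ∀ u ∈ Icc (0:ℝ) h,
      Sum.elim x₀ d₀ + u • Q₃ y₃ y₃ ∈ Icc (Sum.elim lo loD) (Sum.elim hi hiD) := by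
    intro y₃ hy₃ u hu
    have hy : y₃ ∘ Sum.inl ∈ Icc lo hi := ⟨fun c => hy₃.1 (Sum.inl c), fun c => hy₃.2 (Sum.inl c)⟩
    have hd : y₃ ∘ Sum.inr ∈ Icc loD hiD := ⟨fun c => hy₃.1 (Sum.inr c), fun c => hy₃.2 (Sum.inr c)⟩
    have h1 := henc _ hy u hu
    have h2 := hencD _ hy _ hd u hu
    rw [hQ₃]
    refine ⟨?_, ?_⟩ <;> rintro (c | c)
    · simpa using h1.1 c
    · have h' := h2.1 c
      simp only [Pi.add_apply, Pi.smul_apply, smul_eq_mul, Sum.elim_inr] at h' ⊢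
      linarith
    · simpa using h1.2 c
    · have h' := h2.2 c
      simp only [Pi.add_apply, Pi.smul_apply, smul_eq_mul, Sum.elim_inr] at h' ⊢
      linarith
  obtain ⟨ψ₃, h0, hder, hbox⟩ := exists_sol_mem_Icc_of_roughEnclosure Q₃ hx₃ hh henc₃
  refine ⟨fun s => ψ₃ s ∘ Sum.inl, fun s => ψ₃ s ∘ Sum.inl + ψ₃ s ∘ Sum.inr, ?_, ?_, ?_, ?_, ?_, ?_⟩
  · funext c; simp [h0]
  · funext c; simp [h0]
  · intro s hs
    refine hasDerivWithinAt_pi.2 fun c => ?_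
    have h1 := (hasDerivWithinAt_pi.1 (hder s hs)) (Sum.inl c)
    rw [hQ₃] at h1
    simpa using h1
  · intro s hs
    refine hasDerivWithinAt_pi.2 fun c => ?_
    have h1 := (hasDerivWithinAt_pi.1 (hder s hs)) (Sum.inl c)
    have h2 := (hasDerivWithinAt_pi.1 (hder s hs)) (Sum.inr c)
    rw [hQ₃] at h1 h2
    simp only [Sum.elim_inl, Sum.elim_inr] at h1 h2
    have h3 := h1.add h2
    have e := quad_diff_expand Q (ψ₃ s ∘ Sum.inl) (ψ₃ s ∘ Sum.inr) (ψ₃ s ∘ Sum.inl) (ψ₃ s ∘ Sum.inr)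
    refine (h3.congr_deriv ?_)
    have e' := congrFun e c
    simp only [Pi.sub_apply, Pi.add_apply] at e' ⊢
    linarith
  · exact fun s hs => ⟨fun c => (hbox s hs).1 (Sum.inl c), fun c => (hbox s hs).2 (Sum.inl c)⟩
  · intro s hs
    have e : (ψ₃ s ∘ Sum.inl + ψ₃ s ∘ Sum.inr) - ψ₃ s ∘ Sum.inl = ψ₃ s ∘ Sum.inr := add_sub_cancel_left _ _
    rw [e]
    exact ⟨fun c => (hbox s hs).1 (Sum.inr c), fun c => (hbox s hs).2 (Sum.inr c)⟩

/-- **DIFFERENCE LAGRANGE REMAINDER**: for two solutions `ψ`, `ψ'` of `u' = Q(u,u)` on `[0,h]` and a bound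
`|T (ψ' s) (p+1) c − T (ψ s) (p+1) c| ≤ J` along the pair, the first difference obeys
`|(ψ' s − ψ s) c − Σ_{k≤p} (T (ψ' 0) k − T (ψ 0) k) c s^k| ≤ J s^(p+1)` (part 2 on the difference block system).
[folklore] -/
theorem abs_diff_sub_taylor_le (hT0 : ∀ x, T x 0 = x)
    (hTs : ∀ x (k : ℕ) c, ((k : ℝ) + 1) * T x (k + 1) c =
      ∑ i ∈ Finset.range (k + 1), Q (T x i) (T x (k - i)) c)
    {ψ ψ' : ℝ → ι → ℝ} {h : ℝ} (hψ : ∀ s ∈ Icc 0 h, HasDerivWithinAt ψ (Q (ψ s) (ψ s)) (Icc 0 h) s)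
    (hψ' : ∀ s ∈ Icc 0 h, HasDerivWithinAt ψ' (Q (ψ' s) (ψ' s)) (Icc 0 h) s)
    {p : ℕ} {c : ι} {J : ℝ} (hJ : ∀ s ∈ Icc 0 h, |T (ψ' s) (p + 1) c - T (ψ s) (p + 1) c| ≤ J) :
    ∀ s ∈ Icc 0 h, |(ψ' s c - ψ s c) -
      ∑ k ∈ Finset.range (p + 1), (T (ψ' 0) k c - T (ψ 0) k c) * s ^ k| ≤ J * s ^ (p + 1) := by
  obtain ⟨Q₃, T₃, hQ₃, hT₃, hT0₃, hTs₃⟩ := exists_diffJets Q hT0 hTs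
  have hψ₃ : ∀ s ∈ Icc 0 h, HasDerivWithinAt (fun σ => Sum.elim (ψ σ) (ψ' σ - ψ σ))
      (Q₃ (Sum.elim (ψ s) (ψ' s - ψ s)) (Sum.elim (ψ s) (ψ' s - ψ s))) (Icc 0 h) s := by
    intro s hs
    rw [hQ₃]
    refine hasDerivWithinAt_pi.2 ?_
    rintro (c | c)
    · simpa using (hasDerivWithinAt_pi.1 (hψ s hs)) c
    · simp only [Sum.elim_inr, Sum.elim_comp_inl, Sum.elim_comp_inr]
      have h3 := ((hasDerivWithinAt_pi.1 (hψ' s hs)) c).sub ((hasDerivWithinAt_pi.1 (hψ s hs)) c)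
      refine h3.congr_deriv ?_
      have e := congrFun (quad_diff_expand Q (ψ s) (ψ' s - ψ s) (ψ s) (ψ' s - ψ s)) c
      rw [add_sub_cancel] at e
      simpa only [Pi.sub_apply, Pi.add_apply] using e
  have hJ₃ : ∀ s ∈ Icc 0 h, |T₃ (Sum.elim (ψ s) (ψ' s - ψ s)) (p + 1) (Sum.inr c)| ≤ J := fun s hs => by
    simpa [hT₃] using hJ s hs
  intro s hs
  have key := abs_sub_taylor_le Q₃ hT0₃ hTs₃ hψ₃ hJ₃ s hs
  simpa [hT₃] using key

/-- **Box form of the difference remainder**: `ψ` confined to `[lo,hi]`, `ψ' − ψ` to `[loD,hiD]`, and an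
enclosure `|T (y+d) (p+1) c − T y (p+1) c| ≤ J c` over the boxes. [folklore] -/
theorem abs_diff_sub_taylor_le_of_mem_Icc (hT0 : ∀ x, T x 0 = x)
    (hTs : ∀ x (k : ℕ) c, ((k : ℝ) + 1) * T x (k + 1) c =
      ∑ i ∈ Finset.range (k + 1), Q (T x i) (T x (k - i)) c)
    {ψ ψ' : ℝ → ι → ℝ} {h : ℝ} (hψ : ∀ s ∈ Icc 0 h, HasDerivWithinAt ψ (Q (ψ s) (ψ s)) (Icc 0 h) s)
    (hψ' : ∀ s ∈ Icc 0 h, HasDerivWithinAt ψ' (Q (ψ' s) (ψ' s)) (Icc 0 h) s)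
    {lo hi loD hiD : ι → ℝ} (hbox : ∀ s ∈ Icc 0 h, ψ s ∈ Icc lo hi)
    (hboxD : ∀ s ∈ Icc 0 h, ψ' s - ψ s ∈ Icc loD hiD) {p : ℕ} {J : ι → ℝ}
    (hJ : ∀ y ∈ Icc lo hi, ∀ d ∈ Icc loD hiD, ∀ c, |T (y + d) (p + 1) c - T y (p + 1) c| ≤ J c) :
    ∀ s ∈ Icc 0 h, ∀ c, |(ψ' s c - ψ s c) -
      ∑ k ∈ Finset.range (p + 1), (T (ψ' 0) k c - T (ψ 0) k c) * s ^ k| ≤ J c * s ^ (p + 1) := by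
  intro s hs c
  refine abs_diff_sub_taylor_le Q hT0 hTs hψ hψ' (fun σ hσ => ?_) s hs
  have h1 := hJ _ (hbox σ hσ) _ (hboxD σ hσ) c
  rwa [add_sub_cancel] at h1

/-- **High-order test for (trajectory, DIFFERENCE)**: jet enclosures `|T y (p+1) c| ≤ J c` over `[lo,hi]` and
`|T (y+d) (p+1) c − T y (p+1) c| ≤ JD c` over `[lo,hi] × [loD,hiD]`, strict order-`p` tests for `x₀` (jets
`T x₀ k`) and for `d₀` (jet differences `T (x₀+d₀) k − T x₀ k`) ⇒ `ψ`, `ψ'` exist on `[0,h]`, `ψ` confined to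
`[lo,hi]`, `ψ' − ψ` to `[loD,hiD]`. [folklore] -/
theorem exists_pairDiff_sol_mem_Icc_of_highOrderEnclosure (hT0 : ∀ x, T x 0 = x)
    (hTs : ∀ x (k : ℕ) c, ((k : ℝ) + 1) * T x (k + 1) c =
      ∑ i ∈ Finset.range (k + 1), Q (T x i) (T x (k - i)) c)
    {lo hi x₀ loD hiD d₀ : ι → ℝ} {h : ℝ} (hh : 0 ≤ h) {p : ℕ} {J JD : ι → ℝ}
    (hJ : ∀ y ∈ Icc lo hi, ∀ c, |T y (p + 1) c| ≤ J c)
    (hJD : ∀ y ∈ Icc lo hi, ∀ d ∈ Icc loD hiD, ∀ c, |T (y + d) (p + 1) c - T y (p + 1) c| ≤ JD c)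
    (htest : ∀ u ∈ Icc (0:ℝ) h, ∀ c,
      lo c < ∑ k ∈ Finset.range (p + 1), T x₀ k c * u ^ k - J c * u ^ (p + 1) ∧
      ∑ k ∈ Finset.range (p + 1), T x₀ k c * u ^ k + J c * u ^ (p + 1) < hi c)
    (htestD : ∀ u ∈ Icc (0:ℝ) h, ∀ c,
      loD c < ∑ k ∈ Finset.range (p + 1), (T (x₀ + d₀) k c - T x₀ k c) * u ^ k - JD c * u ^ (p + 1) ∧
      ∑ k ∈ Finset.range (p + 1), (T (x₀ + d₀) k c - T x₀ k c) * u ^ k + JD c * u ^ (p + 1) < hiD c) :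
    ∃ ψ ψ' : ℝ → ι → ℝ, ψ 0 = x₀ ∧ ψ' 0 = x₀ + d₀ ∧
      (∀ s ∈ Icc 0 h, HasDerivWithinAt ψ (Q (ψ s) (ψ s)) (Icc 0 h) s) ∧
      (∀ s ∈ Icc 0 h, HasDerivWithinAt ψ' (Q (ψ' s) (ψ' s)) (Icc 0 h) s) ∧
      (∀ s ∈ Icc 0 h, ψ s ∈ Icc lo hi) ∧ (∀ s ∈ Icc 0 h, ψ' s - ψ s ∈ Icc loD hiD) := by
  obtain ⟨Q₃, T₃, hQ₃, hT₃, hT0₃, hTs₃⟩ := exists_diffJets Q hT0 hTs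
  have hJ₃ : ∀ y₃ ∈ Icc (Sum.elim lo loD) (Sum.elim hi hiD), ∀ c₃,
      |T₃ y₃ (p + 1) c₃| ≤ Sum.elim J JD c₃ := by
    intro y₃ hy₃ c₃
    have hy : y₃ ∘ Sum.inl ∈ Icc lo hi := ⟨fun c => hy₃.1 (Sum.inl c), fun c => hy₃.2 (Sum.inl c)⟩
    have hd : y₃ ∘ Sum.inr ∈ Icc loD hiD := ⟨fun c => hy₃.1 (Sum.inr c), fun c => hy₃.2 (Sum.inr c)⟩
    rw [hT₃]
    rcases c₃ with c | c
    · simpa using hJ _ hy c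
    · simpa using hJD _ hy _ hd c
  have htest₃ : ∀ u ∈ Icc (0:ℝ) h, ∀ c₃,
      Sum.elim lo loD c₃ < ∑ k ∈ Finset.range (p + 1), T₃ (Sum.elim x₀ d₀) k c₃ * u ^ k
          - Sum.elim J JD c₃ * u ^ (p + 1) ∧
      ∑ k ∈ Finset.range (p + 1), T₃ (Sum.elim x₀ d₀) k c₃ * u ^ k
          + Sum.elim J JD c₃ * u ^ (p + 1) < Sum.elim hi hiD c₃ := by
    intro u hu c₃
    simp only [hT₃, Sum.elim_comp_inl, Sum.elim_comp_inr]
    rcases c₃ with c | c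
    · simpa using htest u hu c
    · simpa using htestD u hu c
  obtain ⟨ψ₃, h0, hder, hbox⟩ := exists_sol_mem_Icc_of_highOrderEnclosure Q₃ hT0₃ hTs₃ hh hJ₃ htest₃
  refine ⟨fun s => ψ₃ s ∘ Sum.inl, fun s => ψ₃ s ∘ Sum.inl + ψ₃ s ∘ Sum.inr, ?_, ?_, ?_, ?_, ?_, ?_⟩
  · funext c; simp [h0]
  · funext c; simp [h0]
  · intro s hs
    refine hasDerivWithinAt_pi.2 fun c => ?_
    have h1 := (hasDerivWithinAt_pi.1 (hder s hs)) (Sum.inl c)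
    rw [hQ₃] at h1
    simpa using h1
  · intro s hs
    refine hasDerivWithinAt_pi.2 fun c => ?_
    have h1 := (hasDerivWithinAt_pi.1 (hder s hs)) (Sum.inl c)
    have h2 := (hasDerivWithinAt_pi.1 (hder s hs)) (Sum.inr c)
    rw [hQ₃] at h1 h2
    simp only [Sum.elim_inl, Sum.elim_inr] at h1 h2
    have h3 := h1.add h2
    have e := quad_diff_expand Q (ψ₃ s ∘ Sum.inl) (ψ₃ s ∘ Sum.inr) (ψ₃ s ∘ Sum.inl) (ψ₃ s ∘ Sum.inr)
    refine (h3.congr_deriv ?_)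
    have e' := congrFun e c
    simp only [Pi.sub_apply, Pi.add_apply] at e' ⊢
    linarith
  · exact fun s hs => ⟨fun c => (hbox s hs).1 (Sum.inl c), fun c => (hbox s hs).2 (Sum.inl c)⟩
  · intro s hs
    have e : (ψ₃ s ∘ Sum.inl + ψ₃ s ∘ Sum.inr) - ψ₃ s ∘ Sum.inl = ψ₃ s ∘ Sum.inr := add_sub_cancel_left _ _
    rw [e]
    exact ⟨fun c => (hbox s hs).1 (Sum.inr c), fun c => (hbox s hs).2 (Sum.inr c)⟩

end General

/-! ### `Fin n` corollary next to S1's vocabulary -/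

section Majorant

open Summit.NavierStokesRegularity.NavierStokesRegularity.Theorems.TaylorModelMajorant

variable {n : ℕ} {Q : (Fin n → ℝ) → (Fin n → ℝ) → Fin n → ℝ} {w : Fin n → ℝ} {b : ℝ}
  {T : (Fin n → ℝ) → ℕ → Fin n → ℝ} {U : (Fin n → ℝ) → (Fin n → ℝ) → ℕ → Fin n → ℝ}

/-- **Rough-enclosure test for the difference ⇒ the two selectors and their difference**: both `flowSel Q x₀`
and `flowSel Q (x₀ + d₀)` solve on `[0,h]`, the first is confined to `[lo,hi]`, their DIFFERENCE to `[loD,hiD]`,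
and the difference obeys the componentwise remainder against the exact jet differences (given the enclosure
`|T (y+d) (p+1) c − T y (p+1) c| ≤ J c` over the boxes). No `b·m·h < 1`. [folklore] -/
theorem flowSel_diff_of_roughEnclosure (hS : IsMajorantSystem n Q w b T U)
    {lo hi x₀ loD hiD d₀ : Fin n → ℝ} {h : ℝ}
    (hx₀ : x₀ ∈ Icc lo hi) (hd₀ : d₀ ∈ Icc loD hiD) (hh : 0 ≤ h)
    (henc : ∀ y ∈ Icc lo hi, ∀ u ∈ Icc (0:ℝ) h, x₀ + u • Q y y ∈ Icc lo hi)
    (hencD : ∀ y ∈ Icc lo hi, ∀ d ∈ Icc loD hiD, ∀ u ∈ Icc (0:ℝ) h,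
      d₀ + u • (Q y d + Q d y + Q d d) ∈ Icc loD hiD) {p : ℕ} {J : Fin n → ℝ}
    (hJ : ∀ y ∈ Icc lo hi, ∀ d ∈ Icc loD hiD, ∀ c, |T (y + d) (p + 1) c - T y (p + 1) c| ≤ J c) :
    IsSolOn Q x₀ h (fun s => flowSel Q x₀ s) ∧ IsSolOn Q (x₀ + d₀) h (fun s => flowSel Q (x₀ + d₀) s) ∧
      (∀ s ∈ Icc 0 h, flowSel Q x₀ s ∈ Icc lo hi) ∧
      (∀ s ∈ Icc 0 h, flowSel Q (x₀ + d₀) s - flowSel Q x₀ s ∈ Icc loD hiD) ∧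
      ∀ s ∈ Icc 0 h, ∀ c, |(flowSel Q (x₀ + d₀) s c - flowSel Q x₀ s c) -
        ∑ k ∈ Finset.range (p + 1), (T (x₀ + d₀) k c - T x₀ k c) * s ^ k| ≤ J c * s ^ (p + 1) := by
  obtain ⟨Qb, hQb⟩ := exists_bundle hS
  have hTs : ∀ x (k : ℕ) c, ((k : ℝ) + 1) * T x (k + 1) c =
      ∑ i ∈ Finset.range (k + 1), Qb (T x i) (T x (k - i)) c := by
    simpa only [hQb] using hS.T_succ
  have henc' : ∀ y ∈ Icc lo hi, ∀ u ∈ Icc (0:ℝ) h, x₀ + u • Qb y y ∈ Icc lo hi := by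
    simpa only [hQb] using henc
  have hencD' : ∀ y ∈ Icc lo hi, ∀ d ∈ Icc loD hiD, ∀ u ∈ Icc (0:ℝ) h,
      d₀ + u • (Qb y d + Qb d y + Qb d d) ∈ Icc loD hiD := by
    simpa only [hQb] using hencD
  obtain ⟨ψ, ψ', h0, h0', hder, hder', hbox, hboxD⟩ :=
    exists_pairDiff_sol_mem_Icc_of_roughEnclosure Qb hS.T_zero hTs hx₀ hd₀ hh henc' hencD'
  have hsol : IsSolOn Q x₀ h ψ := ⟨h0, by simpa only [hQb] using hder⟩
  have hsol' : IsSolOn Q (x₀ + d₀) h ψ' := ⟨h0', by simpa only [hQb] using hder'⟩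
  have heq : ∀ s ∈ Icc 0 h, flowSel Q x₀ s = ψ s := fun s hs => hS.flowSel_eq hsol hs
  have heq' : ∀ s ∈ Icc 0 h, flowSel Q (x₀ + d₀) s = ψ' s := fun s hs => hS.flowSel_eq hsol' hs
  refine ⟨⟨flowSel_zero x₀, fun s hs => ?_⟩, ⟨flowSel_zero _, fun s hs => ?_⟩, fun s hs => ?_, fun s hs => ?_,
    fun s hs c => ?_⟩
  · show HasDerivWithinAt (fun s => flowSel Q x₀ s) (Q (flowSel Q x₀ s) (flowSel Q x₀ s)) (Icc 0 h) s
    rw [heq s hs]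
    exact (hsol.2 s hs).congr (fun σ hσ => heq σ hσ) (heq s hs)
  · show HasDerivWithinAt (fun s => flowSel Q (x₀ + d₀) s)
      (Q (flowSel Q (x₀ + d₀) s) (flowSel Q (x₀ + d₀) s)) (Icc 0 h) s
    rw [heq' s hs]
    exact (hsol'.2 s hs).congr (fun σ hσ => heq' σ hσ) (heq' s hs)
  · rw [heq s hs]; exact hbox s hs
  · rw [heq s hs, heq' s hs]; exact hboxD s hs
  · have key := abs_diff_sub_taylor_le_of_mem_Icc Qb hS.T_zero hTs hder hder' hbox hboxD hJ s hs c
    rwa [h0, h0', ← heq s hs, ← heq' s hs] at key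

end Majorant

end Summit.NavierStokesRegularity.NavierStokesRegularity.Theorems.TaylorModelVector

end
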